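import Summits.BirchSwinnertonDyer.BirchSwinnertonDyer.Theorems.KatoDescentTamePotSupersingularTameLowerHalfOfKMC
import Summits.BirchSwinnertonDyer.BirchSwinnertonDyer.Theorems.KatoDescentKMCImpReading
import Summits.BirchSwinnertonDyer.Rank1Residual.Additive.QuadraticTwistBSDComparisonIsogeny
import HarnessLib

/-!
# Route `KatoDescentTamePotSupersingular` (rung K8-leaf (t′), cell `bsd-potss`): the crux `TameLowerHalfRankZero`
# (item stmt-BirchSwinnertonDyer-19981) FROM KATO'S MAIN CONJECTURE 12.10 AT THE CLOSED BINDERS —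
# planner SKETCH of duty W1′ (bsd-potss-plan g28; `--supports stmt-BirchSwinnertonDyer-19981 --as helper`)

WHAT. `KatoDescentTamePotSupersingularTameLowerHalfOfKMC.lean` proves the crux BY NAME from Kato's Main Conjecture
at the `p`-torsion-free additive potentially good curves over the INTERFACE triple and the interface lemma
`ReadsTrivialKMC IsOf KMC` (part 10 `Additive.potGoodLowerHalfRankZero_of_kmc_torsionFree` + the slice lemma
`tameLowerHalfRankZero_of_potGoodLowerHalfRankZero`). Cell bsd-cm CLOSED the binders
(`Rank1Residual/Additive/KatoDescentClosedBinders.lean`, p612876) and proved the `→` half of the reading and the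
rank-`0` descent over the `→`-only binder (`KatoDescentKMCImpReading.conj1210_of_isOf_of_kmcFine`,
`…missingPPartAt_rankZero_of_kmcImp`). This file re-proves part 10's uniform rank-`0` lower half over the `→`-only
road at the CLOSED triple (§1) and slices it to the (t′) crux (§2): `TameLowerHalfRankZero` follows from the two
image-free readings at the closed `IsOf`, Cassels / GZK / modularity / Mazur–Kenku, and `KatoMainConjectureFine W' p`
at every `p`-torsion-free additive potentially good `W'` of analytic rank `0`, `p` odd — with NO interface-lemma
hypothesis. HONEST LABEL: conditional over displayed hypotheses; `KatoMainConjectureFine` at an additive prime is an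
OPEN CONJECTURE (Kato Conj. 12.10); closes NOTHING (19981 stays open); nothing about Kato's Main Conjecture or BSD is
asserted; BSD is proved for no curve. Outcome token henceforth: «open-problem: Kato Conj. 12.10 for T_pW at an additive
potentially good p (`Additive.KatoMainConjectureFine W p`) on the residual rows» (D-O6-2 discharged in substance).
[cite: Kato2004Asterisque, Conj. 12.10 (p. 224), §14.14 and Lemma 14.15 (pp. 243–244), Prop. 14.16 (2) (p. 244)]
[cite: Cassels1965ArithmeticVIII] [cite: SilvermanAEC2009, IX.6 Example 6.4]
-/

set_option autoImplicit false
set_option linter.dupNamespace false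

noncomputable section

open scoped Classical

namespace Summit.BirchSwinnertonDyer.BirchSwinnertonDyer.Theorems

open WeierstrassCurve Literature.NumberTheory.EllipticCurves
  Literature.NumberTheory.EllipticCurves.Rank1Residual
  Literature.NumberTheory.EllipticCurves.Rank1Residual.Typed
  Summit.BirchSwinnertonDyer.Rank1Residual.Additive
  Summit.BirchSwinnertonDyer.Rank1Residual
  Summit.BirchSwinnertonDyer.BirchSwinnertonDyer.Theses.KatoDescentTamePotSupersingular

/-- **§1 The UNIFORM rank-`0` lower half `PotGoodLowerHalfRankZero` from Kato's Main Conjecture at the CLOSED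
binders** — part 10's `Additive.potGoodLowerHalfRankZero_of_kmc_torsionFree` with the iff reading replaced by
bsd-cm's kernel `→` half: at a torsion-free member `W′ ∼ W` (Mazur–Kenku, `Addv.exists_torsionFree_member`) the
`→`-only descent `missingPPartAt_rankZero_of_kmcImp` gives the `p`-part at `W′`, whose lower half transports to
`W` along the isogeny (`TwistComparison.missingLowerBoundAt_of_isIsogenous`: Cassels + GZK + modularity).
Conditional; nothing credited. [cite: Kato2004Asterisque, Conj. 12.10 (p. 224), Prop. 14.16 (2) (p. 244)]
[cite: Cassels1965ArithmeticVIII] [cite: SilvermanAEC2009, IX.6 Example 6.4] -/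
theorem potGoodLowerHalfRankZero_of_kmcFine
    (hR : TorsionFree.DescentCountReading IsKatoZetaDescentDatumOf)
    (hreal : TorsionFree.RealizableOfKMC IsKatoZetaDescentDatumOf KatoMainConjectureFine)
    (hCassels : bsdRHS_eq_of_isIsogenous) (hGZK : rank_eq_analyticRank_of_analyticRank_le_one)
    (hmod : hasEntireLFunction_rat) (hMK : mazurKenku_exists_cyclic_isogeny)
    (hK : ∀ (W : WeierstrassCurve ℚ) [W.IsElliptic] [W.IsGloballyMinimal] (p : ℕ) [Fact p.Prime],
      W.analyticRank = 0 → p ≠ 2 → Addv W p → 0 ≤ padicValRat p W.j → ¬ p ∣ W.torsionOrder →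
        KatoMainConjectureFine W p) :
    PotGoodLowerHalfRankZero := by
  intro W _ _ p _ hr hp2 hadd hj
  obtain ⟨W', hW', hM', hiso, hadd', hj', ht'⟩ := Addv.exists_torsionFree_member hMK hp2 hadd hj
  haveI := hW'
  haveI := hM'
  have hr' : W'.analyticRank = 0 := by rw [← analyticRank_eq_of_isIsogenous' hiso, hr]
  have hM : MissingPPartAt W' p :=
    KatoDescentKMCImpReading.missingPPartAt_rankZero_of_kmcImp W' p hR hreal
      KatoDescentKMCImpReading.conj1210_of_isOf_of_kmcFine hGZK hmod hr' hp2 hadd' hj' ht'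
      (hK W' p hr' hp2 hadd' hj' ht')
  exact TwistComparison.missingLowerBoundAt_of_isIsogenous W' W p hCassels hGZK hmod
    hiso.symm_of_charZero (by rw [hr']; exact zero_le_one) (lower_and_upper_of_missingPPartAt W' p hM).1

/-- **§2 `TameLowerHalfRankZero` (KT crux 19981) from Kato's Main Conjecture 12.10 at the CLOSED binders** —
the (t′) slice of §1 (`tameLowerHalfRankZero_of_potGoodLowerHalfRankZero`). Conditional; the item is NOT closed.
[cite: Kato2004Asterisque, Conj. 12.10 (p. 224)] -/
theorem tameLowerHalfRankZero_of_kmcFine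
    (hR : TorsionFree.DescentCountReading IsKatoZetaDescentDatumOf)
    (hreal : TorsionFree.RealizableOfKMC IsKatoZetaDescentDatumOf KatoMainConjectureFine)
    (hCassels : bsdRHS_eq_of_isIsogenous) (hGZK : rank_eq_analyticRank_of_analyticRank_le_one)
    (hmod : hasEntireLFunction_rat) (hMK : mazurKenku_exists_cyclic_isogeny)
    (hK : ∀ (W : WeierstrassCurve ℚ) [W.IsElliptic] [W.IsGloballyMinimal] (p : ℕ) [Fact p.Prime],
      W.analyticRank = 0 → p ≠ 2 → Addv W p → 0 ≤ padicValRat p W.j → ¬ p ∣ W.torsionOrder →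
        KatoMainConjectureFine W p) :
    Summit.BirchSwinnertonDyer.BirchSwinnertonDyer.Theses.KatoDescentTamePotSupersingular.TameLowerHalfRankZero :=
  tameLowerHalfRankZero_of_potGoodLowerHalfRankZero
    (potGoodLowerHalfRankZero_of_kmcFine hR hreal hCassels hGZK hmod hMK hK)

end Summit.BirchSwinnertonDyer.BirchSwinnertonDyer.Theorems

end
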